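import Literature.MathematicalPhysics.QuantumFieldTheory.Balaban1983to89.B15TreeGaugeT0
import Literature.MathematicalPhysics.QuantumFieldTheory.Balaban1983to89.B15TreeGauge196Bridge

/-!
# `Balaban1983to89.B15TreeGaugeT0Bridge` — T. Bałaban, *Large field renormalization. I. The basic step of the 𝐑 operation*, Commun. Math. Phys. **122** (1989) 175–202 [Balaban1989LargeFieldI], p. 196: the DICTIONARY between the two typings of the tree `T₀` on `𝐁₀` — the `T₀`-paths as lattice WORDS (`B15TreeGaugeT0`, seat p26) and the bond FINSET `T₀ = ⋃ (trees) ∪ (external bonds)` of `B15TreeGraph196` §8 (seat r12, PROVED to be a tree) — PROVED: every bond traversed by a `T₀`-path is a bond of r12's `T₀`, hence "`V′ = 1` on the bonds of `T₀`" gives p26's gauge conditions `T0Gauge`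

statement-level skeleton of published theorems with citation tags; proofs where landed; nothing here is a claim about the Yang–Mills mass gap

PDF held: `paper:balaban1989-cmp122-large-field-i` (journal page = PDF page + 174; p. 196 = PDF p. 22, text layer re-read for
this file).

WHAT IS REPRODUCED (mega-formalization `lit-balaban`, HOME `run/shared/lean/pub/lit-balaban/`, Phase-2 seat p26, generation 5;
SKELETON rows **B15.Def@196** (r12) and **B15.Claim@196**).  P. 196, verbatim: *"The union of the above described tree graphs
and bonds is denoted by T₀. It is a tree graph in 𝐁₀, fixing completely a gauge in this set. … We fix the gauge putting the
bond variables equal to 1 for bonds belonging to the tree graph."*  THE TWO TYPINGS: `B15TreeGaugeT0.t0word lo hi τ i x`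
spells the `T₀`-path from the corner `y⁰` of `Λ` to a site `x` of the layer `Pⁱ∖Pⁱ⁺¹` as a word (the reading used for the
gauge transformation `v(x) = V(T₀-path)` and the Stokes estimates of PARTS 5–6); `B15TreeGraph196.T0 lo hi (fun _ ↦ τ) m`
lists the unit bonds of `T₀` (the reading in which *"It is a tree graph in 𝐁₀"* is PROVED, `T0_isTree`, `card_T0_eq`).
This file proves, via r12's dictionary `B15TreeGauge196Bridge.wordBonds_contour` for single contours: (§1)
`bondsOneAlong_of_wordBonds` — the gauge conditions along a word follow from `V = 1` on the bonds it traverses (and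
conversely); (§2) `wordBonds_chainWord_subset_T0`, **`wordBonds_t0word_subset_T0`** — every bond traversed by a `T₀`-path is
a bond of r12's `T₀` (the chain word runs through the trees `T(Pʲ, Pʲ⁺¹)` and the printed external bonds `extBond lo (j+1) =
⟨yʲ⁺¹ − e₁, yʲ⁺¹⟩`, `j < i`); (§3) **`T0Gauge.of_eq_one_on_T0`** — if `V′(b) = 1` for every bond `b` of r12's `T₀` then
p26's `T0Gauge V′ lo hi τ m` holds, so PART 6's `RegHypT0.tree` IS the printed gauge fixing on the tree that r12 proved to
be a tree.

HONEST SCOPE.  Single-scale model with a common threshold (as `B15TreeGaugeT0`; r12's `T0` with the constant threshold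
sequence `fun _ ↦ τ`); lattice dimension `d = n + 3` (r12's carrier `LPt (n + 1)`).  Every declaration is a proved lemma of
lattice combinatorics; nothing of [IV] is asserted.  Unit `lit-balaban-p26` (literature-prover-lit-balaban-p26-g5-0).
-/

noncomputable section

namespace Literature.MathematicalPhysics.QuantumFieldTheory.Balaban1983to89.B15TreeGauge196

open B7Prop1Explicit B8Lemma1NonAbelian B16Ineq382
open B15TreeGauge196Bridge (bondOf wordBonds wordBonds_nil wordBonds_cons wordBonds_append wordBonds_contour)

variable {n : ℕ}

/-! ## §1 Gauge conditions along a word = `V = 1` on the bonds it traverses -/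

section Words

variable {d : ℕ} {G : Type*} [Group G] {V : Site d → Fin d → G}

/-- The bond variable met by a letter is the variable of the bond it traverses (forward) or its inverse (backward):
`stepHol V x l = 1 ↔ V (bondOf x l) = 1`. [cite: Balaban1989LargeFieldI, p.196] -/
theorem stepHol_eq_one_iff (x : Site d) (l : Letter d) : stepHol V x l = 1 ↔ V (bondOf x l).1 (bondOf x l).2 = 1 := by
  obtain ⟨μ, b⟩ := l
  cases b
  · rw [stepHol_false]
    simp [bondOf, Letter.vec, sub_eq_add_neg]
  · rw [stepHol_true]
    simp [bondOf]

/-- **`V = 1` on the traversed bonds ⇔ the gauge conditions along the word** (PART 3's `BondsOneAlong`). [cite: Balaban1989LargeFieldI, p.196] -/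
theorem bondsOneAlong_iff_wordBonds :
    ∀ {x : Site d} {w : List (Letter d)}, BondsOneAlong V x w ↔ ∀ b ∈ wordBonds x w, V b.1 b.2 = 1
  | x, [] => by simp [bondsOneAlong_nil, wordBonds_nil]
  | x, l :: w => by
    rw [bondsOneAlong_cons, wordBonds_cons, stepHol_eq_one_iff, bondsOneAlong_iff_wordBonds]
    simp only [Finset.mem_insert, forall_eq_or_imp]

/-- The direction used: `V = 1` on the traversed bonds gives the gauge conditions along the word. [cite: Balaban1989LargeFieldI, p.196] -/
theorem bondsOneAlong_of_wordBonds {x : Site d} {w : List (Letter d)} (h : ∀ b ∈ wordBonds x w, V b.1 b.2 = 1) :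
    BondsOneAlong V x w :=
  bondsOneAlong_iff_wordBonds.mpr h

end Words

/-! ## §2 Every bond traversed by a `T₀`-path is a bond of r12's `T₀` -/

section T0Bonds

variable {lo hi : ℕ → Site (n + 3)} {τ : ℤ} {m : ℕ}

/-- `e i0` is r12's `unitVec 0` and `i0` is r12's index `0` (dimension bookkeeping `n + 3 = (n + 1) + 2`). [cite: Balaban1989LargeFieldI, p.196] -/
theorem e_i0_eq_unitVec : (e (i0 : Fin (n + 3)) : Site (n + 3)) = B6BondElimination.unitVec (0 : Fin (n + 1 + 2)) := by
  funext κ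
  rw [e_apply, B6BondElimination.unitVec_apply]
  have : (κ = i0) ↔ (κ = (0 : Fin (n + 1 + 2))) := by
    constructor <;> intro h <;> exact Fin.ext (by rw [h]; rfl)
  simp only [this]

/-- The printed external bond of `Pⁱ⁺¹` as r12 records it: `(yⁱ⁺¹ − e₁, e₁) = extBond lo (i+1)`. [cite: Balaban1989LargeFieldI, p.196] -/
theorem extBond_eq (lo : ℕ → Site (n + 3)) (i : ℕ) :
    B15TreeGraph196.extBond (n := n + 1) lo i = (lo i - e i0, (i0 : Fin (n + 3))) := by
  rw [B15TreeGraph196.extBond, e_i0_eq_unitVec]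
  rfl

/-- A site of p26's layer is a point of r12's (Finset) annulus. [cite: Balaban1989LargeFieldI, p.196] -/
theorem mem_graphAnn_of_mem_layer {i : ℕ} {x : Site (n + 3)} (hx : x ∈ layer lo hi i) :
    x ∈ B15TreeGraph196.ann (n := n + 1) (lo i) (hi i) (lo (i + 1)) (hi (i + 1)) := by
  rw [B15TreeGraph196.mem_ann, B15TreeGraph196.mem_box, B15TreeGraph196.mem_box]
  exact ⟨fun κ => mem_box_iff.mp hx.1 κ, fun h => hx.2 (mem_box_iff.mpr h)⟩

/-- The trees of the consecutive pairs are parts of `T₀`. [cite: Balaban1989LargeFieldI, p.196] -/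
theorem tree_subset_T0 {i : ℕ} (him : i < m) :
    B15TreeGraph196.tree (n := n + 1) (lo i) (hi i) (lo (i + 1)) (hi (i + 1)) τ ⊆
      B15TreeGraph196.T0 (n := n + 1) lo hi (fun _ => τ) m := by
  intro b hb
  rw [B15TreeGraph196.T0, Finset.mem_union, Finset.mem_biUnion]
  exact Or.inl ⟨i, Finset.mem_range.mpr him, hb⟩

/-- The external bonds are bonds of `T₀`. [cite: Balaban1989LargeFieldI, p.196] -/
theorem extBond_mem_T0 {i : ℕ} (him : i < m) :
    B15TreeGraph196.extBond (n := n + 1) lo i ∈ B15TreeGraph196.T0 (n := n + 1) lo hi (fun _ => τ) m := by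
  rw [B15TreeGraph196.T0, Finset.mem_union, Finset.mem_image]
  exact Or.inr ⟨i, Finset.mem_range.mpr him, rfl⟩

/-- **The bonds traversed by a contour `Γ^i_{yⁱ,x}` of a layer are bonds of `T₀`** (r12's dictionary `wordBonds_contour` +
`tree ⊆ T₀`). [cite: Balaban1989LargeFieldI, p.196] -/
theorem wordBonds_contour_subset_T0 {i : ℕ} (him : i < m) {x : Site (n + 3)} (hx : x ∈ layer lo hi i) :
    wordBonds (lo i) (contour (lo i) (hi i) τ x) ⊆ B15TreeGraph196.T0 (n := n + 1) lo hi (fun _ => τ) m := by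
  have hxb := mem_box_iff.mp hx.1
  rw [wordBonds_contour (fun κ => (hxb κ).1) (fun κ => (hxb κ).2)]
  intro b hb
  exact tree_subset_T0 him (B15TreeGraph196.mem_tree.mpr ⟨x, mem_graphAnn_of_mem_layer hx, hb⟩)

/-- **The bonds traversed by the chain word are bonds of `T₀`**: `chainWord i` runs through the trees of the layers
`j < i` and the external bonds `⟨yʲ⁺¹ − e₁, yʲ⁺¹⟩`. [cite: Balaban1989LargeFieldI, p.196] -/
theorem wordBonds_chainWord_subset_T0 (hC : ChainGeom lo hi τ m) :
    ∀ {i : ℕ}, i < m → wordBonds (lo 0) (chainWord lo i) ⊆ B15TreeGraph196.T0 (n := n + 1) lo hi (fun _ => τ) m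
  | 0, _ => by simp [wordBonds_nil]
  | i + 1, him => by
    have him' : i < m := by omega
    rw [chainWord_succ_eq hC him', wordBonds_append, add_disp_chainWord, wordBonds_append, disp_contour,
      show lo i + (lo (i + 1) - e i0 - lo i) = lo (i + 1) - e i0 by abel, wordBonds_cons, wordBonds_nil]
    refine Finset.union_subset (wordBonds_chainWord_subset_T0 hC him') (Finset.union_subset
      (wordBonds_contour_subset_T0 him' (hC.extEnd_mem_layer (Nat.succ_le_of_lt him'))) ?_)
    rw [Finset.insert_empty, Finset.singleton_subset_iff, show bondOf (lo (i + 1) - e i0) ((i0 : Fin (n + 3)), true) =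
      (lo (i + 1) - e i0, (i0 : Fin (n + 3))) by simp [bondOf], ← extBond_eq]
    exact extBond_mem_T0 him

/-- **Every bond traversed by a `T₀`-path is a bond of r12's `T₀`.** [cite: Balaban1989LargeFieldI, p.196] -/
theorem wordBonds_t0word_subset_T0 (hC : ChainGeom lo hi τ m) {i : ℕ} (him : i < m) {x : Site (n + 3)}
    (hx : x ∈ layer lo hi i) :
    wordBonds (lo 0) (t0word lo hi τ i x) ⊆ B15TreeGraph196.T0 (n := n + 1) lo hi (fun _ => τ) m := by
  rw [t0word, wordBonds_append, add_disp_chainWord]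
  exact Finset.union_subset (wordBonds_chainWord_subset_T0 hC him) (wordBonds_contour_subset_T0 him hx)

end T0Bonds

/-! ## §3 `V′ = 1` on r12's `T₀` gives p26's gauge conditions -/

section Gauge

variable {lo hi : ℕ → Site (n + 3)} {τ : ℤ} {m : ℕ} {G : Type*} [Group G] {V' : Site (n + 3) → Fin (n + 3) → G}

/-- **p. 196 "bond variables equal to 1 for bonds belonging to the tree graph" ⇒ `T0Gauge`**: if `V′(b) = 1` for every
bond `b = (z, e_μ)` of r12's `T₀` (the tree of `T0_isTree`), then the gauge conditions of PART 4 hold along every contour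
of every layer and on the external bonds. [cite: Balaban1989LargeFieldI, p.196] -/
theorem T0Gauge.of_eq_one_on_T0
    (h : ∀ b ∈ B15TreeGraph196.T0 (n := n + 1) lo hi (fun _ => τ) m, V' b.1 b.2 = 1) : T0Gauge V' lo hi τ m where
  tree i him x hx := bondsOneAlong_of_wordBonds fun b hb => h b (wordBonds_contour_subset_T0 him hx hb)
  ext i him := by
    have hb := h _ (extBond_mem_T0 (lo := lo) (hi := hi) (τ := τ) (i := i + 1) him)
    rwa [extBond_eq] at hb

/-- … and then the gauge conditions hold along every `T₀`-path (`BondsOneAlong V′ y⁰ (t0word i x)`). [cite: Balaban1989LargeFieldI, p.196] -/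
theorem bondsOneAlong_t0word_of_eq_one_on_T0 (hC : ChainGeom lo hi τ m)
    (h : ∀ b ∈ B15TreeGraph196.T0 (n := n + 1) lo hi (fun _ => τ) m, V' b.1 b.2 = 1) {i : ℕ} (him : i < m)
    {x : Site (n + 3)} (hx : x ∈ layer lo hi i) : BondsOneAlong V' (lo 0) (t0word lo hi τ i x) :=
  bondsOneAlong_of_wordBonds fun b hb => h b (wordBonds_t0word_subset_T0 hC him hx hb)

end Gauge

end Literature.MathematicalPhysics.QuantumFieldTheory.Balaban1983to89.B15TreeGauge196
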